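/-
Copyright: cell pub-balaban-gaps, seat ne8 (estimate NE7c), gen 11. Project licence.
-/
import Summits.QuantumFields.BalabanUV.T4Continuum.Spine.NE7b.LogConcaveShiftedFibre
import Summits.QuantumFields.BalabanUV.T4Continuum.Spine.NE7c.LiveFactorLogConcave

/-!
# Road (δ) on the log-concave road, SHIFTED window: leaf-01's `logConcaveShiftedMoment_le_of_inducedMean_le` with its displacement letter
# DISCHARGED at live letters (row NE7c; junction J-8, the one application held back in file 21)

Cell `pub-balaban-gaps` (G2), seat ne8, estimate **NE7c** (`T4IndicatorShell.ShellWeightBound`; two-run artefact, NOT PRINTED in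
[Bałaban 1983–89], NOT PROVED).  Twenty-second proof-only file under `Spine/NE7c/`: the §3 of file 21's draft, filed once leaf-01 g79's
(4) `Spine/NE7b/LogConcaveShiftedFibre` (p366194 ✓) was in the tree; consumed BY NAME with file 21 `LiveFactorLogConcave` (`displacement_live`);
nothing of Bałaban's is named; 0 `sorry`.

WHAT IS PROVED ([folklore]): `logConcaveShiftedMoment_le_of_inducedMean_le_live` — for EVERY assignment `s` of live factors (`λ₀ ≤ s_b`), an
even midpoint-log-concave window `0 ≤ F ≤ 1` covered by large-field conditions at LIVE thresholds `s_b²θ_b`, assignment-free induced-mean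
letters `m₀ᵀQ_bm₀ ≤ μ_b`, `m₀ᵀQm₀ ≤ B₀` (`m₀ = S⁻¹v`), and `η₀ = Σ_b e^{−(λ₀²θ_b − (1+ε⁻¹)μ_b)∕(1+ε)}(√(1−δ′))⁻¹^{r_b} < 1`:
`∫ F e^{xᵀQx} e^{−(xᵀSx + 2xᵀv)} ≤ (e^{B₀∕(1−δ)}·(√(1−δ))⁻¹^r ∕ (1 − η₀)) · ∫ F e^{−(xᵀSx + 2xᵀv)}` — leaf-01's theorem with `hdisp`
supplied by file 21's `displacement_live`: ONE constant for the grid; census row 42 sits in `η₀` alone on this road (LOSS `× λ₀²` below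
file 19's clause), `B₀` is the far pattern (FREE).  BY-NAME EFFECT ON THE WALL: none.

NOT HERE (honest): Bałaban's windows ∕ remainders; node O; NE7c.  VERDICT WORD UNCHANGED: WORK-bound behind node O; INSTANCE 0∕1.
NE7c ∕ NE7b NOT PRINTED ∕ NOT PROVED; spine 0∕9; one finite T⁴ — NOT ℝ⁴, NOT infinite volume, NOT the mass gap, NOT Clay.
HONEST DEPENDENCY (cell): continuum YM on T⁴ ⇐ BetaPertH ∧ nine spine estimates (0∕9 proved); BetaPertH ⇐ (D1) ∧ (D4) ∧ CAP+tail.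
-/

set_option autoImplicit false

namespace Summit.QuantumFields.BalabanUV.T4Continuum.Spine.NE7c.LiveFactorLogConcaveShifted

open Matrix Finset MeasureTheory Real
open Summit.QuantumFields.BalabanUV.T4Continuum.NE7b.LogConcaveShiftedFibre
open Summit.QuantumFields.BalabanUV.T4Continuum.Spine.NE7c.LiveFactorLogConcave

variable {n : Type*} [Fintype n] [DecidableEq n]

/-- **THE SHIFTED MOMENT OF AN EVEN LOG-CONCAVE WINDOW AT LIVE LETTERS.**  Leaf-01's `logConcaveShiftedMoment_le_of_inducedMean_le` BY NAME
with its displacement letter `hdisp` DISCHARGED by file 21's `displacement_live` at `m₀ = S⁻¹v`: for EVERY assignment `s` of live factors,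
`∫ F e^{xᵀQx} e^{−(xᵀSx + 2xᵀv)} ≤ (e^{B₀∕(1−δ)}·(√(1−δ))⁻¹^r ∕ (1 − η₀)) · ∫ F e^{−(xᵀSx + 2xᵀv)}` with the assignment-free
`η₀ = Σ_b e^{−(λ₀²θ_b − (1+ε⁻¹)μ_b)∕(1+ε)}·(√(1−δ′))⁻¹^{r_b}` — ONE constant for the grid. [folklore] -/
theorem logConcaveShiftedMoment_le_of_inducedMean_le_live {ι : Type*} (B : Finset ι) {S Q : Matrix n n ℝ}
    (Qb : ι → Matrix n n ℝ) (θ μb : ι → ℝ) (rb : ι → ℕ) {δ δ' B₀ ε : ℝ} {r : ℕ} (hS : S.PosDef) (hQ : Q.PosSemidef)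
    (hdom : (δ • S - Q).PosSemidef) (hδ0 : 0 ≤ δ) (hδ : δ < 1) (hr : Q.rank ≤ r)
    (hQb : ∀ b ∈ B, (Qb b).PosSemidef) (hdomb : ∀ b ∈ B, (δ' • S - Qb b).PosSemidef) (hδ'0 : 0 ≤ δ') (hδ' : δ' < 1)
    (hrb : ∀ b ∈ B, (Qb b).rank ≤ rb b) (v : n → ℝ) {F : (n → ℝ) → ℝ} (hF0 : ∀ x, 0 ≤ F x) (hF1 : ∀ x, F x ≤ 1)
    (hFm : Measurable F) (hFe : ∀ x, F (-x) = F x) (hFlc : ∀ x y, F x * F y ≤ F ((2 : ℝ)⁻¹ • (x + y)) ^ 2)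
    (s : ι → ℝ) {lam₀ : ℝ} (h0 : 0 ≤ lam₀) (hs : ∀ b ∈ B, lam₀ ≤ s b) (hθ : ∀ b ∈ B, 0 ≤ θ b)
    (hcov : ∀ x, 1 - F x ≤ ∑ b ∈ B, Set.indicator {x | s b ^ 2 * θ b ≤ x ⬝ᵥ (Qb b *ᵥ x)} (fun _ => (1 : ℝ)) x)
    (hm : ∀ b ∈ B, (S⁻¹ *ᵥ v) ⬝ᵥ (Qb b *ᵥ (S⁻¹ *ᵥ v)) ≤ μb b) (hB : (S⁻¹ *ᵥ v) ⬝ᵥ (Q *ᵥ (S⁻¹ *ᵥ v)) ≤ B₀) (hε : 0 < ε)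
    (hη : ∑ b ∈ B, exp (-((lam₀ ^ 2 * θ b - (1 + ε⁻¹) * μb b) / (1 + ε))) * (√(1 - δ'))⁻¹ ^ rb b < 1) :
    ∫ x, F x * (exp (x ⬝ᵥ (Q *ᵥ x)) * exp (-(x ⬝ᵥ (S *ᵥ x) + 2 * (x ⬝ᵥ v)))) ≤
      (exp (B₀ / (1 - δ)) * (√(1 - δ))⁻¹ ^ r /
          (1 - ∑ b ∈ B, exp (-((lam₀ ^ 2 * θ b - (1 + ε⁻¹) * μb b) / (1 + ε))) * (√(1 - δ'))⁻¹ ^ rb b)) *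
        ∫ x, F x * exp (-(x ⬝ᵥ (S *ᵥ x) + 2 * (x ⬝ᵥ v))) :=
  logConcaveShiftedMoment_le_of_inducedMean_le hS hQ hdom hδ0 hδ hr v hF0 hFm hFe hFlc hη
    (displacement_live B Qb θ μb rb hS hQb hdomb hδ'0 hδ' hrb hF0 hF1 hFm s h0 hs hθ hcov (S⁻¹ *ᵥ v) hm hε) hB

end Summit.QuantumFields.BalabanUV.T4Continuum.Spine.NE7c.LiveFactorLogConcaveShifted
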